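import Mathlib
import Literature.MathematicalPhysics.StatisticalMechanics.LennardJonesClusters

/-!
# Crux `NearFarGlueR` (stmt-AtomisticToContinuum-14970), line `Sketch`: stub `stub_fibre`

The packing / fibre count used twice by the bookkeeping stub `stub_glue` of the line: in a
`δ`-separated configuration `x : Fin N → ℝ³` (`δ > 0`), if every particle of `S` has a particle of
`T` within distance `R ≥ 0`, then `#S ≤ (2R/δ + 1)³ · #T`.

Proof: `S` is covered by the fibres `{j ∈ S | dist (x j) (x k) ≤ R}`, `k ∈ T` (no choice needed:
every `j ∈ S` lies in the fibre of its witness).  Each fibre, mapped injectively by `x` (injective by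
`δ`-separation), is a finite `δ`-separated set of points within `R` of `x k`, hence has at most
`(2R/δ + 1)³` elements by the volume packing bound `card_le_of_separated_of_dist_le` (disjoint
`δ/2`-balls inside a ball of radius `R + δ/2`, `finrank ℝ ℝ³ = 3`).  Summing over `k ∈ T`
(`Finset.card_biUnion_le`) gives the claim.
-/

noncomputable section

namespace Summit.AtomisticToContinuum.Crystallization.Theorems.PhononSlackCertificatesNearFarGlueR

open Literature.MathematicalPhysics.StatisticalMechanics
open scoped BigOperators RealInnerProductSpace

/-- **Injectivity from separation.** A `δ`-separated configuration with `δ > 0` is injective.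
[folklore] -/
theorem fibre_injective_of_separated {N : ℕ} {x : Fin N → EuclideanSpace ℝ (Fin 3)} {δ : ℝ}
    (hδ : 0 < δ) (hsep : ∀ i j : Fin N, i ≠ j → δ ≤ dist (x i) (x j)) :
    Function.Injective x := by
  intro i j hij
  by_contra hne
  have h := hsep i j hne
  rw [hij, dist_self] at h
  exact absurd h (not_le.2 hδ)

/-- **One fibre.** In a `δ`-separated configuration of `ℝ³` (`δ > 0`, `R ≥ 0`), the particles of `S`
within distance `R` of a fixed particle `k` number at most `(2R/δ + 1)³`
(`card_le_of_separated_of_dist_le` applied to their (injective) image under `x`). [folklore] -/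
theorem fibre_card_filter_le {N : ℕ} (x : Fin N → EuclideanSpace ℝ (Fin 3)) {δ R : ℝ}
    (hδ : 0 < δ) (hR : 0 ≤ R) (hsep : ∀ i j : Fin N, i ≠ j → δ ≤ dist (x i) (x j))
    (S : Finset (Fin N)) (k : Fin N) :
    ((S.filter fun j => dist (x j) (x k) ≤ R).card : ℝ) ≤ (2 * R / δ + 1) ^ 3 := by
  classical
  have h1 : (((S.filter fun j => dist (x j) (x k) ≤ R).image x).card : ℝ) ≤
      (2 * R / δ + 1) ^ Module.finrank ℝ (EuclideanSpace ℝ (Fin 3)) := by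
    refine card_le_of_separated_of_dist_le _ (x k) hδ hR ?_ ?_
    · intro c hc
      obtain ⟨j, hj, rfl⟩ := Finset.mem_image.1 hc
      exact (Finset.mem_filter.1 hj).2
    · intro c hc d hd hcd
      obtain ⟨i, -, rfl⟩ := Finset.mem_image.1 hc
      obtain ⟨i', -, rfl⟩ := Finset.mem_image.1 hd
      exact hsep i i' fun h => hcd (congrArg x h)
  rwa [Finset.card_image_of_injective _ (fibre_injective_of_separated hδ hsep),
    finrank_euclideanSpace_fin] at h1

/-- **Fibre / packing count.** In a `δ`-separated configuration of `ℝ³` (`δ > 0`, `R ≥ 0`), if every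
particle of `S` has a particle of `T` within distance `R`, then `#S ≤ (2R/δ + 1)³ · #T`: `S` is
covered by the `T`-indexed fibres, each of cardinality at most `(2R/δ + 1)³`
(`fibre_card_filter_le`, i.e. `card_le_of_separated_of_dist_le`). [folklore] -/
theorem stub_fibre :
    ∀ (δ R : ℝ), 0 < δ → 0 ≤ R → ∀ (N : ℕ) (x : Fin N → EuclideanSpace ℝ (Fin 3)),
      (∀ i j : Fin N, i ≠ j → δ ≤ dist (x i) (x j)) →
      ∀ S T : Finset (Fin N), (∀ j ∈ S, ∃ k ∈ T, dist (x j) (x k) ≤ R) →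
        (S.card : ℝ) ≤ (2 * R / δ + 1) ^ 3 * (T.card : ℝ) := by
  intro δ R hδ hR N x hsep S T hST
  classical
  have hcover : S ⊆ T.biUnion fun k => S.filter fun j => dist (x j) (x k) ≤ R := by
    intro j hj
    obtain ⟨k, hk, hjk⟩ := hST j hj
    exact Finset.mem_biUnion.2 ⟨k, hk, Finset.mem_filter.2 ⟨hj, hjk⟩⟩
  calc (S.card : ℝ)
      ≤ ((T.biUnion fun k => S.filter fun j => dist (x j) (x k) ≤ R).card : ℝ) := by
        exact_mod_cast Finset.card_le_card hcover
    _ ≤ ∑ k ∈ T, ((S.filter fun j => dist (x j) (x k) ≤ R).card : ℝ) := by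
        exact_mod_cast Finset.card_biUnion_le
    _ ≤ ∑ k ∈ T, (2 * R / δ + 1) ^ 3 :=
        Finset.sum_le_sum fun k _ => fibre_card_filter_le x hδ hR hsep S k
    _ = (2 * R / δ + 1) ^ 3 * (T.card : ℝ) := by
        rw [Finset.sum_const, nsmul_eq_mul, mul_comm]

end Summit.AtomisticToContinuum.Crystallization.Theorems.PhononSlackCertificatesNearFarGlueR

end
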